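import Mathlib
import Summits.Ventures.PercRepro2.Defs
import Summits.Ventures.PercRepro2.Harris
import Summits.Ventures.PercRepro2.Graph
import Summits.Ventures.PercRepro2.Induced
import Summits.Ventures.PercRepro2.VdBKahn
import Summits.Ventures.PercRepro2.NestIID
import Summits.Ventures.PercRepro2.SideDefs

/-!
# (SIDE) holds whenever the status law is log-supermodular (blind cell PercRepro2, mine-1 g12;
MINE-1.md §28, proofs/MINE1-SIDE.md §7)

If the status masses `W S = statusMass T F S` satisfy the FKG lattice condition on `2^F`,
`W S · W S' ≤ W (S ∩ S') · W (S ∪ S')`, then the complementary two-copy measure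
`μ S = W S · W (F ∖ S)` is log-supermodular too (`F ∖ (S ∪ S') = (F ∖ S) ∩ (F ∖ S')` and
`F ∖ (S ∩ S') = (F ∖ S) ∪ (F ∖ S')`), so Mathlib's FKG inequality (`fkg`) applies to it. For
intersecting up-sets `Λ, Λ'`, with `f = 1[· ∈ Λ]`, `g = 1[· ∈ Λ']` (monotone) and
`h = 1[F ∖ · ∈ Λ']` (antitone), FKG gives `(Σμf)(Σμg) ≤ Z·Σμfg` and (applied to `f` and `1 − h`)
`Z·Σμfh ≤ (Σμf)(Σμh)`; the complementation symmetry `μ (F ∖ S) = μ S` gives `Σμh = Σμg`; hence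
`Z·Σμfh ≤ Z·Σμfg`, i.e. the opposite-side mass is at most the same-side mass: `SideIneq`.

This is the whole mechanism in the cases where the status law IS log-supermodular — e.g. on
every FOREST (the rooted-subtree cluster law is log-modular on the lattice of rooted subtrees and
the status map is a lattice homomorphism; proofs/MINE1-SIDE.md §7) — and it shows exactly what
fails in general: on general graphs the status law is NOT log-supermodular (MINE-1.md §28 (N3)),
although (SIDE) still holds in every census.
-/

namespace Summit.Ventures.PercRepro2

section SideLogSupermod

variable {V : Type*} {E : Type*} [Fintype E] [DecidableEq E] [Fintype V] [DecidableEq V]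
  {R : Type*} [CommRing R] [LinearOrder R] [IsStrictOrderedRing R]

variable (p : E → R) (ends : E → Sym2 V) (s : V) (T F : Finset V)

/-- The status law is log-supermodular on `2^F` (the FKG lattice condition for the masses
`W S = P(C ∩ F = S, C ∩ T = ∅)`). -/
def StatusLogSupermod : Prop :=
  ∀ S S' : Finset V, S ⊆ F → S' ⊆ F →
    statusMass p ends s T F S * statusMass p ends s T F S' ≤
      statusMass p ends s T F (S ∩ S') * statusMass p ends s T F (S ∪ S')

/-- The complementary two-copy measure `μ S = W S · W (F ∖ S)`, extended by `0` outside `2^F`. -/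
noncomputable def compMu (S : Finset V) : R :=
  if S ⊆ F then compMass p ends s T F S else 0

variable {p}

omit [Fintype V] in
/-- Status masses are probabilities, hence nonnegative. -/
lemma statusMass_nonneg (hp : IsProbVec p) (S : Finset V) : 0 ≤ statusMass p ends s T F S :=
  prob_nonneg hp _

omit [Fintype V] in
/-- The complementary two-copy mass is nonnegative. -/
lemma compMass_nonneg (hp : IsProbVec p) (S : Finset V) : 0 ≤ compMass p ends s T F S :=
  mul_nonneg (statusMass_nonneg ends s T F hp S) (statusMass_nonneg ends s T F hp _)

omit [Fintype V] in
/-- `μ` is nonnegative. -/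
lemma compMu_nonneg (hp : IsProbVec p) (S : Finset V) : 0 ≤ compMu p ends s T F S := by
  unfold compMu; split_ifs
  · exact compMass_nonneg ends s T F hp S
  · exact le_rfl

omit [Fintype V] [LinearOrder R] [IsStrictOrderedRing R] in
/-- On subsets of `F`, `μ` is the complementary mass. -/
lemma compMu_of_subset {S : Finset V} (hS : S ⊆ F) :
    compMu p ends s T F S = compMass p ends s T F S := by
  simp [compMu, hS]

omit [Fintype V] [LinearOrder R] [IsStrictOrderedRing R] in
/-- Outside `2^F`, `μ` vanishes. -/
lemma compMu_of_not_subset {S : Finset V} (hS : ¬ S ⊆ F) : compMu p ends s T F S = 0 := by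
  simp [compMu, hS]

omit [Fintype V] [LinearOrder R] [IsStrictOrderedRing R] in
/-- Complementation symmetry of the two-copy measure. -/
lemma compMu_sdiff {S : Finset V} (hS : S ⊆ F) :
    compMu p ends s T F (F \ S) = compMu p ends s T F S := by
  rw [compMu_of_subset ends s T F Finset.sdiff_subset, compMu_of_subset ends s T F hS]
  unfold compMass
  rw [Finset.sdiff_sdiff_eq_self hS, mul_comm]

omit [Fintype V] in
/-- `μ` is log-supermodular on the lattice `Finset V` when the status law is. -/
lemma compMu_logSupermod (hp : IsProbVec p) (hW : StatusLogSupermod p ends s T F)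
    (a b : Finset V) :
    compMu p ends s T F a * compMu p ends s T F b ≤
      compMu p ends s T F (a ⊓ b) * compMu p ends s T F (a ⊔ b) := by
  by_cases ha : a ⊆ F
  · by_cases hb : b ⊆ F
    · have hab : a ⊓ b ⊆ F := Finset.Subset.trans Finset.inter_subset_left ha
      have hab' : a ⊔ b ⊆ F := Finset.union_subset ha hb
      rw [compMu_of_subset ends s T F ha, compMu_of_subset ends s T F hb,
        compMu_of_subset ends s T F hab, compMu_of_subset ends s T F hab']
      unfold compMass
      have e1 : F \ (a ⊓ b) = (F \ a) ∪ (F \ b) := by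
        ext v; simp only [Finset.inf_eq_inter, Finset.mem_sdiff, Finset.mem_inter,
          Finset.mem_union]; tauto
      have e2 : F \ (a ⊔ b) = (F \ a) ∩ (F \ b) := by
        ext v; simp only [Finset.sup_eq_union, Finset.mem_sdiff, Finset.mem_union,
          Finset.mem_inter]; tauto
      have h1 := hW a b ha hb
      have h2 := hW (F \ a) (F \ b) Finset.sdiff_subset Finset.sdiff_subset
      rw [e1, e2]
      have hn : ∀ S, 0 ≤ statusMass p ends s T F S := statusMass_nonneg ends s T F hp
      calc statusMass p ends s T F a * statusMass p ends s T F (F \ a) *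
            (statusMass p ends s T F b * statusMass p ends s T F (F \ b))
          = (statusMass p ends s T F a * statusMass p ends s T F b) *
            (statusMass p ends s T F (F \ a) * statusMass p ends s T F (F \ b)) := by ring
        _ ≤ (statusMass p ends s T F (a ⊓ b) * statusMass p ends s T F (a ⊔ b)) *
            (statusMass p ends s T F ((F \ a) ∩ (F \ b)) *
              statusMass p ends s T F ((F \ a) ∪ (F \ b))) :=
            mul_le_mul h1 h2 (mul_nonneg (hn _) (hn _)) (mul_nonneg (hn _) (hn _))
        _ = statusMass p ends s T F (a ⊓ b) * statusMass p ends s T F ((F \ a) ∪ (F \ b)) *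
            (statusMass p ends s T F (a ⊔ b) * statusMass p ends s T F ((F \ a) ∩ (F \ b))) := by
            ring
    · rw [compMu_of_not_subset ends s T F hb, mul_zero]
      exact mul_nonneg (compMu_nonneg ends s T F hp _) (compMu_nonneg ends s T F hp _)
  · rw [compMu_of_not_subset ends s T F ha, zero_mul]
    exact mul_nonneg (compMu_nonneg ends s T F hp _) (compMu_nonneg ends s T F hp _)

omit [LinearOrder R] [IsStrictOrderedRing R] in
/-- A filtered sum over `2^F` is a full sum against `μ`. -/
lemma sum_filter_eq_sum_compMu (P : Finset V → Prop) [DecidablePred P] :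
    ∑ S ∈ F.powerset.filter P, compMass p ends s T F S =
      ∑ S : Finset V, compMu p ends s T F S * (if P S then 1 else 0) := by
  rw [Finset.sum_filter]
  rw [← Finset.sum_subset (Finset.subset_univ F.powerset)]
  · refine Finset.sum_congr rfl fun S hS => ?_
    rw [compMu_of_subset ends s T F (Finset.mem_powerset.mp hS)]
    split_ifs <;> simp
  · intro S _ hS
    rw [compMu_of_not_subset ends s T F (fun h => hS (Finset.mem_powerset.mpr h)), zero_mul]

omit [LinearOrder R] [IsStrictOrderedRing R] in
/-- Reindexing by complementation within `F`. -/
lemma sum_compMu_sdiff (φ : Finset V → R) :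
    ∑ S : Finset V, compMu p ends s T F S * φ (F \ S) =
      ∑ S : Finset V, compMu p ends s T F S * φ S := by
  have hz : ∀ S ∈ (Finset.univ : Finset (Finset V)), S ∉ F.powerset →
      compMu p ends s T F S * φ (F \ S) = 0 := by
    intro S _ hS
    rw [compMu_of_not_subset ends s T F (fun h => hS (Finset.mem_powerset.mpr h)), zero_mul]
  have hz' : ∀ S ∈ (Finset.univ : Finset (Finset V)), S ∉ F.powerset →
      compMu p ends s T F S * φ S = 0 := by
    intro S _ hS
    rw [compMu_of_not_subset ends s T F (fun h => hS (Finset.mem_powerset.mpr h)), zero_mul]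
  rw [← Finset.sum_subset (Finset.subset_univ F.powerset) hz,
    ← Finset.sum_subset (Finset.subset_univ F.powerset) hz']
  refine Finset.sum_nbij' (fun S => F \ S) (fun S => F \ S) ?_ ?_ ?_ ?_ ?_
  · intro S _; exact Finset.mem_powerset.mpr Finset.sdiff_subset
  · intro S _; exact Finset.mem_powerset.mpr Finset.sdiff_subset
  · intro S hS; exact Finset.sdiff_sdiff_eq_self (Finset.mem_powerset.mp hS)
  · intro S hS; exact Finset.sdiff_sdiff_eq_self (Finset.mem_powerset.mp hS)
  · intro S hS
    rw [compMu_sdiff ends s T F (Finset.mem_powerset.mp hS)]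

/-- **(SIDE) from log-supermodularity of the status law** (Mathlib's FKG inequality on
`Finset V`, the complementation symmetry of `μ`, and the reverse FKG for an antitone factor). -/
theorem sideIneq_of_statusLogSupermod (hp : IsProbVec p)
    (hW : StatusLogSupermod p ends s T F) : SideIneq p ends s T F := by
  intro Λ Λ'
  classical
  -- the three indicator functions
  let f : Finset V → R := fun S => if S ∩ F ∈ Λ.fam then 1 else 0
  let g : Finset V → R := fun S => if S ∩ F ∈ Λ'.fam then 1 else 0
  let h : Finset V → R := fun S => if F \ S ∈ Λ'.fam then 1 else 0
  let k : Finset V → R := fun S => 1 - h S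
  have hμ0 : (0 : Finset V → R) ≤ compMu p ends s T F := fun S => compMu_nonneg ends s T F hp S
  have hf0 : (0 : Finset V → R) ≤ f := fun S => by
    simp only [f, Pi.zero_apply]; split_ifs <;> norm_num
  have hg0 : (0 : Finset V → R) ≤ g := fun S => by
    simp only [g, Pi.zero_apply]; split_ifs <;> norm_num
  have hh1 : ∀ S, h S ≤ 1 := fun S => by simp only [h]; split_ifs <;> norm_num
  have hk0 : (0 : Finset V → R) ≤ k := fun S => by
    simp only [k, Pi.zero_apply]; linarith [hh1 S]
  have hfmono : Monotone f := by
    intro S S' hSS'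
    simp only [f]
    by_cases h1 : S ∩ F ∈ Λ.fam
    · have h2 : S' ∩ F ∈ Λ.fam :=
        Λ.upper _ h1 _ (Finset.inter_subset_inter hSS' (le_refl F)) Finset.inter_subset_right
      simp [h1, h2]
    · simp only [h1, if_false]
      split_ifs <;> norm_num
  have hgmono : Monotone g := by
    intro S S' hSS'
    simp only [g]
    by_cases h1 : S ∩ F ∈ Λ'.fam
    · have h2 : S' ∩ F ∈ Λ'.fam :=
        Λ'.upper _ h1 _ (Finset.inter_subset_inter hSS' (le_refl F)) Finset.inter_subset_right
      simp [h1, h2]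
    · simp only [h1, if_false]
      split_ifs <;> norm_num
  have hkmono : Monotone k := by
    intro S S' hSS'
    simp only [k, h]
    by_cases h2 : F \ S' ∈ Λ'.fam
    · have h1 : F \ S ∈ Λ'.fam :=
        Λ'.upper _ h2 _ (Finset.sdiff_subset_sdiff (le_refl F) hSS') Finset.sdiff_subset
      simp [h1, h2]
    · simp only [h2, if_false]
      split_ifs <;> norm_num
  have hμls : ∀ a b, compMu p ends s T F a * compMu p ends s T F b ≤
      compMu p ends s T F (a ⊓ b) * compMu p ends s T F (a ⊔ b) :=
    fun a b => compMu_logSupermod ends s T F hp hW a b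
  -- FKG twice
  have fkg1 := fkg f g (compMu p ends s T F) hμ0 hf0 hg0 hfmono hgmono hμls
  have fkg2 := fkg f k (compMu p ends s T F) hμ0 hf0 hk0 hfmono hkmono hμls
  -- symmetry: Σ μ h = Σ μ g
  have hsym : ∑ S, compMu p ends s T F S * h S = ∑ S, compMu p ends s T F S * g S := by
    have := sum_compMu_sdiff (p := p) ends s T F (fun S => if S ∈ Λ'.fam then (1 : R) else 0)
    simp only [h, g]
    rw [this]
    refine Finset.sum_congr rfl fun S _ => ?_
    by_cases hS : S ⊆ F
    · have e : S ∩ F = S := Finset.inter_eq_left.mpr hS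
      rw [e]
    · rw [compMu_of_not_subset ends s T F hS, zero_mul, zero_mul]
  -- expand Σ μ k and Σ μ f k
  have hk1 : ∑ S, compMu p ends s T F S * k S =
      ∑ S, compMu p ends s T F S - ∑ S, compMu p ends s T F S * h S := by
    rw [← Finset.sum_sub_distrib]
    refine Finset.sum_congr rfl fun S _ => ?_
    simp only [k]; ring
  have hk2 : ∑ S, compMu p ends s T F S * (f S * k S) =
      ∑ S, compMu p ends s T F S * f S - ∑ S, compMu p ends s T F S * (f S * h S) := by
    rw [← Finset.sum_sub_distrib]
    refine Finset.sum_congr rfl fun S _ => ?_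
    simp only [k]; ring
  rw [hk1, hk2] at fkg2
  -- conclude: Z · Σμfh ≤ (Σμf)(Σμh) = (Σμf)(Σμg) ≤ Z · Σμfg
  have hZD : (∑ S, compMu p ends s T F S) * ∑ S, compMu p ends s T F S * (f S * h S) ≤
      (∑ S, compMu p ends s T F S) * ∑ S, compMu p ends s T F S * (f S * g S) := by
    have e1 : (∑ S, compMu p ends s T F S) * ∑ S, compMu p ends s T F S * (f S * h S) ≤
        (∑ S, compMu p ends s T F S * f S) * ∑ S, compMu p ends s T F S * h S := by
      have m1 := mul_sub (∑ S, compMu p ends s T F S * f S) (∑ S, compMu p ends s T F S)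
        (∑ S, compMu p ends s T F S * h S)
      have m2 := mul_sub (∑ S, compMu p ends s T F S) (∑ S, compMu p ends s T F S * f S)
        (∑ S, compMu p ends s T F S * (f S * h S))
      have m3 := mul_comm (∑ S, compMu p ends s T F S) (∑ S, compMu p ends s T F S * f S)
      linarith [fkg2, m1, m2, m3]
    rw [hsym] at e1
    exact le_trans e1 fkg1
  have hZ0 : 0 ≤ ∑ S, compMu p ends s T F S := Finset.sum_nonneg fun S _ => hμ0 S
  have hDC : ∑ S, compMu p ends s T F S * (f S * h S) ≤
      ∑ S, compMu p ends s T F S * (f S * g S) := by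
    rcases hZ0.lt_or_eq with hpos | hzero
    · exact le_of_mul_le_mul_left hZD hpos
    · have hall : ∀ S ∈ (Finset.univ : Finset (Finset V)), compMu p ends s T F S = 0 :=
        (Finset.sum_eq_zero_iff_of_nonneg fun S _ => hμ0 S).mp hzero.symm
      have hD : ∑ S, compMu p ends s T F S * (f S * h S) = 0 :=
        Finset.sum_eq_zero fun S _ => by rw [hall S (Finset.mem_univ _), zero_mul]
      have hC : ∑ S, compMu p ends s T F S * (f S * g S) = 0 :=
        Finset.sum_eq_zero fun S _ => by rw [hall S (Finset.mem_univ _), zero_mul]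
      rw [hD, hC]
  -- translate the two filtered sums
  have eL : ∑ S ∈ F.powerset.filter (fun S => S ∈ Λ.fam ∧ F \ S ∈ Λ'.fam),
      compMass p ends s T F S = ∑ S, compMu p ends s T F S * (f S * h S) := by
    rw [sum_filter_eq_sum_compMu ends s T F]
    refine Finset.sum_congr rfl fun S _ => ?_
    by_cases hS : S ⊆ F
    · have e : S ∩ F = S := Finset.inter_eq_left.mpr hS
      simp only [f, h, e]
      by_cases h1 : S ∈ Λ.fam <;> by_cases h2 : F \ S ∈ Λ'.fam <;> simp [h1, h2]
    · rw [compMu_of_not_subset ends s T F hS, zero_mul, zero_mul]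
  have eR : ∑ S ∈ F.powerset.filter (fun S => S ∈ Λ.fam ∧ S ∈ Λ'.fam),
      compMass p ends s T F S = ∑ S, compMu p ends s T F S * (f S * g S) := by
    rw [sum_filter_eq_sum_compMu ends s T F]
    refine Finset.sum_congr rfl fun S _ => ?_
    by_cases hS : S ⊆ F
    · have e : S ∩ F = S := Finset.inter_eq_left.mpr hS
      simp only [f, g, e]
      by_cases h1 : S ∈ Λ.fam <;> by_cases h2 : S ∈ Λ'.fam <;> simp [h1, h2]
    · rw [compMu_of_not_subset ends s T F hS, zero_mul, zero_mul]
  rw [eL, eR]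
  exact hDC

end SideLogSupermod

end Summit.Ventures.PercRepro2
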